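import Summits.KontsevichZagierPeriods.KontsevichZagierPeriods.Theorems.LinRedNormalFormArrangementNormalFormStubRebaseSimplePosOnePosQuadFinal
import Summits.KontsevichZagierPeriods.KontsevichZagierPeriods.Theorems.LinRedNormalFormArrangementNormalFormStubRebaseSimplePosOnePosDCornerPar

/-!
# Stub `stub_rebaseSimplePosOnePos` (crux `ArrangementNormalForm`, line `janus-bands`) —
part `TwoOfHU`: the stub at `b = 0` modulo the residue `HU` alone

Assembly over the base `(x₁, x₂, y)` (`B = 2`). By part `DCornerPar` the double-corner
hypotheses `Hdthick` / `Hdfar` of `rebaseSimplePosOnePos_two_of_U'` (part `QuadFinal`) follow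
from `Hpar` (parallel bands above the letter, same base factor), and by parts `ParThinQuadCell`
(`RebasePos.good_par_of_thinQuad`, any `ε > 0`) and `QuadFinal` (`RebasePos.good_quadCell_two`,
the quadruple points) `Hpar` at `B = 2` follows from the single residue `HU`: the `ε`-thin
parallel cells over a product cell whose closed cell carries a triple point `h = w = κ' = 0` with
the base pole at distance `≥ δ > 0` (`RebasePos.good_par_two_of_HU`, registered as
`rebaseSimplePos_par_two_of_HU`). Hence (`rebaseSimplePosOnePos_two_of_HU'`, the stub's exact
statement at `b = 0` plus `ε`, `hε`, `HU`):
`GS 2 1 → closure (GG 2 2 1 ∪ JJ 2 2 ∪ JD 3)` modulo `KZ.relations` as soon as `HU` holds.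

References: M. Kontsevich, D. Zagier, *Periods* (2001), §1.2, rules (1a), (1b), (2).
-/

noncomputable section

open Set MeasureTheory MvPolynomial
open Literature.NumberTheory.Transcendental Literature.ModelTheory.ExponentialFields

namespace Summit.KontsevichZagierPeriods.ArrangementNormalForm.JanusBands

namespace RebasePos

open SeparatePos

section TwoOfHU

variable {m m' : ℕ} (L : Fin m → (Fin (0 + 1 + 1) → ℚ) × ℚ) (e : Fin m → ℕ) (ℓ₁ ℓ₂ : (Fin (0 + 1 + 1) → ℚ) × ℚ)

/-- **`Hpar` at `B = 2` from `HU`.** A parallel band above its letter `0` over the base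
`(x₁, x₂, y)` is congruent modulo `KZ.relations` to the subgroup generated by `GG 2 2 1` as soon
as the `ε`-thin far-side product cells with a triple point at pole distance `≥ δ` are (`HU`):
`good_par_of_thinQuad` with its `Q`-branch discharged by `good_quadCell_two`. -/
theorem good_par_two_of_HU (ε : ℚ) (hε : 0 < ε) (s : KZ.IntegralRep (0 + 1 + 1 + 1 + 1))
    (M : Fin m' → (Fin (0 + 1 + 1 + 1) → ℚ) × ℚ) (p : MvPolynomial (Fin (0 + 1 + 1)) ℚ) (u v : (Fin (0 + 1 + 1 + 1) → ℚ) × ℚ)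
    (hbd : Bornology.IsBounded s.domain)
    (hdom : s.domain = gDom (0 + 1 + 1) 1 m' M (fun _ => Sum.inr u) (fun _ => Sum.inr v))
    (hint : EqOn s.integrand (glit (0 + 1 + 1) 1 p L e ℓ₁ ℓ₂ 0 1 (fun _ => some 0)) s.domain)
    (hu : u.1 (Fin.last (0 + 1 + 1)) ≠ 0) (hpar : u.1 (Fin.last (0 + 1 + 1)) = v.1 (Fin.last (0 + 1 + 1)))
    (hcell : ∀ z : Fin (0 + 1 + 1 + 1 + 1) → ℝ, (∀ j, 0 < affF (0 + 1 + 1) 1 (M j) z) →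
      0 < affF (0 + 1 + 1) 1 u z ∧ affF (0 + 1 + 1) 1 u z < affF (0 + 1 + 1) 1 v z)
    (HU : ∀ (m'' m₀' : ℕ) (s' : KZ.IntegralRep (0 + 1 + 1 + 1 + 1)) (M' : Fin m'' → (Fin (0 + 1 + 1 + 1) → ℚ) × ℚ)
      (M₀' : Fin m₀' → (Fin (0 + 1 + 1) → ℚ) × ℚ) (ylo' yhi' : (Fin (0 + 1 + 1) → ℚ) × ℚ), Bornology.IsBounded s'.domain →
      s'.domain = gDom (0 + 1 + 1) 1 m'' M' (fun _ => Sum.inr u) (fun _ => Sum.inr v) →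
      EqOn s'.integrand (glit (0 + 1 + 1) 1 p L e ℓ₁ ℓ₂ 0 1 (fun _ => some 0)) s'.domain →
      (∀ z : Fin (0 + 1 + 1 + 1 + 1) → ℝ, (∀ j, 0 < affF (0 + 1 + 1) 1 (M' j) z) → 0 < affF (0 + 1 + 1) 1 u z ∧ affF (0 + 1 + 1) 1 u z < affF (0 + 1 + 1) 1 v z) →
      (∀ z : Fin (0 + 1 + 1 + 1 + 1) → ℝ, (∀ j, 0 < affF (0 + 1 + 1) 1 (M' j) z) ↔ ((∀ j, 0 < affB (0 + 1 + 1) 1 (M₀' j) z) ∧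
        affB (0 + 1 + 1) 1 ylo' z < z (Fin.castAdd 1 (Fin.last (0 + 1 + 1))) ∧ z (Fin.castAdd 1 (Fin.last (0 + 1 + 1))) < affB (0 + 1 + 1) 1 yhi' z)) →
      (∀ z : Fin (0 + 1 + 1 + 1 + 1) → ℝ, (∀ j, 0 < affB (0 + 1 + 1) 1 (M₀' j) z) → affB (0 + 1 + 1) 1 ylo' z < affB (0 + 1 + 1) 1 yhi' z) →
      (∀ z : Fin (0 + 1 + 1 + 1 + 1) → ℝ, (∀ j, 0 < affB (0 + 1 + 1) 1 (M₀' j) z) →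
        (0 < u.1 (Fin.last (0 + 1 + 1)) → affB (0 + 1 + 1) 1 ℓ₂ z ≤ affB (0 + 1 + 1) 1 ylo' z) ∧ (u.1 (Fin.last (0 + 1 + 1)) < 0 → affB (0 + 1 + 1) 1 yhi' z ≤ affB (0 + 1 + 1) 1 ℓ₂ z)) →
      (∀ z : Fin (0 + 1 + 1 + 1 + 1) → ℝ, (∀ j, 0 < affB (0 + 1 + 1) 1 (M₀' j) z) →
        affF (0 + 1 + 1) 1 v z - affF (0 + 1 + 1) 1 u z < ε * (affB (0 + 1 + 1) 1 yhi' z - affB (0 + 1 + 1) 1 ylo' z)) →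
      (∃ δ : ℝ, 0 < δ ∧ ∀ z : Fin (0 + 1 + 1 + 1 + 1) → ℝ, (∀ j, 0 < affB (0 + 1 + 1) 1 (M₀' j) z) →
        δ ≤ |affB (0 + 1 + 1) 1 ylo' z - affB (0 + 1 + 1) 1 ℓ₂ z| ∧ δ ≤ |affB (0 + 1 + 1) 1 yhi' z - affB (0 + 1 + 1) 1 ℓ₂ z|) →
      (∃ z ∈ closure {z : Fin (0 + 1 + 1 + 1 + 1) → ℝ | ∀ j, 0 < affF (0 + 1 + 1) 1 (M' j) z},
        affB (0 + 1 + 1) 1 ylo' z = affB (0 + 1 + 1) 1 yhi' z ∧ affF (0 + 1 + 1) 1 u z = affF (0 + 1 + 1) 1 v z ∧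
          affB (0 + 1 + 1) 1 (restr (0 + 1 + 1) u) z + (u.1 (Fin.last (0 + 1 + 1)) : ℝ) * affB (0 + 1 + 1) 1 ℓ₂ z = 0) →
      ∃ c ∈ AddSubgroup.closure (GGset (0 + 1 + 1) 2 1), KZ.of s' - c ∈ KZ.relations) :
    ∃ c ∈ AddSubgroup.closure (GGset (0 + 1 + 1) 2 1), KZ.of s - c ∈ KZ.relations :=
  good_par_of_thinQuad L e ℓ₁ ℓ₂ ε hε s M p u v hbd hdom hint hu hpar hcell HU
    fun _ _ s' M' M₀' ylo' yhi' hbd' hdom' hint' hcell' hsec' _ _ _ hq =>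
      good_quadCell_two L e ℓ₁ ℓ₂ s' M' M₀' ylo' yhi' p u v hbd' hdom' hint' hu hpar hcell' hsec' hq

/-- **`Hdthick` at `B = 2` from `HU`** (`good_dthick_of_par` + `good_par_two_of_HU`). -/
theorem good_dthick_two_of_HU (ε : ℚ) (hε : 0 < ε) (s : KZ.IntegralRep (0 + 1 + 1 + 1 + 1))
    (M : Fin m' → (Fin (0 + 1 + 1 + 1) → ℚ) × ℚ) (p : MvPolynomial (Fin (0 + 1 + 1)) ℚ)
    (u v κ : (Fin (0 + 1 + 1 + 1) → ℚ) × ℚ) (A : ℚ) (hbd : Bornology.IsBounded s.domain)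
    (hdom : s.domain = gDom (0 + 1 + 1) 1 m' M (fun _ => Sum.inr u) (fun _ => Sum.inr v))
    (hint : EqOn s.integrand (glit (0 + 1 + 1) 1 p L e ℓ₁ ℓ₂ 0 1 (fun _ => some 0)) s.domain)
    (hκ : κ.1 (Fin.last (0 + 1 + 1)) = 0) (hA : u - κ = A • (v - u)) (hA0 : 0 < A)
    (hcell : ∀ z : Fin (0 + 1 + 1 + 1 + 1) → ℝ, (∀ j, 0 < affF (0 + 1 + 1) 1 (M j) z) →
      affF (0 + 1 + 1) 1 κ z < 0 ∧ 0 < affF (0 + 1 + 1) 1 u z ∧ affF (0 + 1 + 1) 1 u z < affF (0 + 1 + 1) 1 v z)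
    (HU : ∀ (u' v' : (Fin (0 + 1 + 1 + 1) → ℚ) × ℚ), u'.1 (Fin.last (0 + 1 + 1)) ≠ 0 → u'.1 (Fin.last (0 + 1 + 1)) = v'.1 (Fin.last (0 + 1 + 1)) →
      ∀ (m'' m₀' : ℕ) (s' : KZ.IntegralRep (0 + 1 + 1 + 1 + 1)) (M' : Fin m'' → (Fin (0 + 1 + 1 + 1) → ℚ) × ℚ)
      (M₀' : Fin m₀' → (Fin (0 + 1 + 1) → ℚ) × ℚ) (ylo' yhi' : (Fin (0 + 1 + 1) → ℚ) × ℚ), Bornology.IsBounded s'.domain →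
      s'.domain = gDom (0 + 1 + 1) 1 m'' M' (fun _ => Sum.inr u') (fun _ => Sum.inr v') →
      EqOn s'.integrand (glit (0 + 1 + 1) 1 p L e ℓ₁ ℓ₂ 0 1 (fun _ => some 0)) s'.domain →
      (∀ z : Fin (0 + 1 + 1 + 1 + 1) → ℝ, (∀ j, 0 < affF (0 + 1 + 1) 1 (M' j) z) → 0 < affF (0 + 1 + 1) 1 u' z ∧ affF (0 + 1 + 1) 1 u' z < affF (0 + 1 + 1) 1 v' z) →
      (∀ z : Fin (0 + 1 + 1 + 1 + 1) → ℝ, (∀ j, 0 < affF (0 + 1 + 1) 1 (M' j) z) ↔ ((∀ j, 0 < affB (0 + 1 + 1) 1 (M₀' j) z) ∧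
        affB (0 + 1 + 1) 1 ylo' z < z (Fin.castAdd 1 (Fin.last (0 + 1 + 1))) ∧ z (Fin.castAdd 1 (Fin.last (0 + 1 + 1))) < affB (0 + 1 + 1) 1 yhi' z)) →
      (∀ z : Fin (0 + 1 + 1 + 1 + 1) → ℝ, (∀ j, 0 < affB (0 + 1 + 1) 1 (M₀' j) z) → affB (0 + 1 + 1) 1 ylo' z < affB (0 + 1 + 1) 1 yhi' z) →
      (∀ z : Fin (0 + 1 + 1 + 1 + 1) → ℝ, (∀ j, 0 < affB (0 + 1 + 1) 1 (M₀' j) z) →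
        (0 < u'.1 (Fin.last (0 + 1 + 1)) → affB (0 + 1 + 1) 1 ℓ₂ z ≤ affB (0 + 1 + 1) 1 ylo' z) ∧ (u'.1 (Fin.last (0 + 1 + 1)) < 0 → affB (0 + 1 + 1) 1 yhi' z ≤ affB (0 + 1 + 1) 1 ℓ₂ z)) →
      (∀ z : Fin (0 + 1 + 1 + 1 + 1) → ℝ, (∀ j, 0 < affB (0 + 1 + 1) 1 (M₀' j) z) →
        affF (0 + 1 + 1) 1 v' z - affF (0 + 1 + 1) 1 u' z < ε * (affB (0 + 1 + 1) 1 yhi' z - affB (0 + 1 + 1) 1 ylo' z)) →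
      (∃ δ : ℝ, 0 < δ ∧ ∀ z : Fin (0 + 1 + 1 + 1 + 1) → ℝ, (∀ j, 0 < affB (0 + 1 + 1) 1 (M₀' j) z) →
        δ ≤ |affB (0 + 1 + 1) 1 ylo' z - affB (0 + 1 + 1) 1 ℓ₂ z| ∧ δ ≤ |affB (0 + 1 + 1) 1 yhi' z - affB (0 + 1 + 1) 1 ℓ₂ z|) →
      (∃ z ∈ closure {z : Fin (0 + 1 + 1 + 1 + 1) → ℝ | ∀ j, 0 < affF (0 + 1 + 1) 1 (M' j) z},
        affB (0 + 1 + 1) 1 ylo' z = affB (0 + 1 + 1) 1 yhi' z ∧ affF (0 + 1 + 1) 1 u' z = affF (0 + 1 + 1) 1 v' z ∧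
          affB (0 + 1 + 1) 1 (restr (0 + 1 + 1) u') z + (u'.1 (Fin.last (0 + 1 + 1)) : ℝ) * affB (0 + 1 + 1) 1 ℓ₂ z = 0) →
      ∃ c ∈ AddSubgroup.closure (GGset (0 + 1 + 1) 2 1), KZ.of s' - c ∈ KZ.relations) :
    ∃ c ∈ AddSubgroup.closure (GGset (0 + 1 + 1) 2 1), KZ.of s - c ∈ KZ.relations :=
  good_dthick_of_par L e ℓ₁ ℓ₂ s M p u v κ A hbd hdom hint hκ hA hA0 hcell
    fun _ s' M' u' v' hbd' hdom' hint' hu' hpar' hcell' =>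
      good_par_two_of_HU L e ℓ₁ ℓ₂ ε hε s' M' p u' v' hbd' hdom' hint' hu' hpar' hcell' (HU u' v' hu' hpar')

/-- **`Hdfar` at `B = 2` from `HU`** (`good_dfar_of_par` + `good_par_two_of_HU`). -/
theorem good_dfar_two_of_HU (ε : ℚ) (hε : 0 < ε) (s : KZ.IntegralRep (0 + 1 + 1 + 1 + 1))
    (M : Fin m' → (Fin (0 + 1 + 1 + 1) → ℚ) × ℚ) (p : MvPolynomial (Fin (0 + 1 + 1)) ℚ)
    (u v κ : (Fin (0 + 1 + 1 + 1) → ℚ) × ℚ) (A : ℚ) (hbd : Bornology.IsBounded s.domain)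
    (hdom : s.domain = gDom (0 + 1 + 1) 1 m' M (fun _ => Sum.inr u) (fun _ => Sum.inr v))
    (hint : EqOn s.integrand (glit (0 + 1 + 1) 1 p L e ℓ₁ ℓ₂ 0 1 (fun _ => some 0)) s.domain)
    (hκ : κ.1 (Fin.last (0 + 1 + 1)) = 0) (hA : u - κ = A • (v - u)) (hA0 : 0 < A)
    (hcell : ∀ z : Fin (0 + 1 + 1 + 1 + 1) → ℝ, (∀ j, 0 < affF (0 + 1 + 1) 1 (M j) z) →
      0 < affF (0 + 1 + 1) 1 κ z ∧ affF (0 + 1 + 1) 1 u z < affF (0 + 1 + 1) 1 v z ∧ 2 * affF (0 + 1 + 1) 1 κ z ≤ affF (0 + 1 + 1) 1 v z)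
    (HU : ∀ (u' v' : (Fin (0 + 1 + 1 + 1) → ℚ) × ℚ), u'.1 (Fin.last (0 + 1 + 1)) ≠ 0 → u'.1 (Fin.last (0 + 1 + 1)) = v'.1 (Fin.last (0 + 1 + 1)) →
      ∀ (m'' m₀' : ℕ) (s' : KZ.IntegralRep (0 + 1 + 1 + 1 + 1)) (M' : Fin m'' → (Fin (0 + 1 + 1 + 1) → ℚ) × ℚ)
      (M₀' : Fin m₀' → (Fin (0 + 1 + 1) → ℚ) × ℚ) (ylo' yhi' : (Fin (0 + 1 + 1) → ℚ) × ℚ), Bornology.IsBounded s'.domain →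
      s'.domain = gDom (0 + 1 + 1) 1 m'' M' (fun _ => Sum.inr u') (fun _ => Sum.inr v') →
      EqOn s'.integrand (glit (0 + 1 + 1) 1 p L e ℓ₁ ℓ₂ 0 1 (fun _ => some 0)) s'.domain →
      (∀ z : Fin (0 + 1 + 1 + 1 + 1) → ℝ, (∀ j, 0 < affF (0 + 1 + 1) 1 (M' j) z) → 0 < affF (0 + 1 + 1) 1 u' z ∧ affF (0 + 1 + 1) 1 u' z < affF (0 + 1 + 1) 1 v' z) →
      (∀ z : Fin (0 + 1 + 1 + 1 + 1) → ℝ, (∀ j, 0 < affF (0 + 1 + 1) 1 (M' j) z) ↔ ((∀ j, 0 < affB (0 + 1 + 1) 1 (M₀' j) z) ∧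
        affB (0 + 1 + 1) 1 ylo' z < z (Fin.castAdd 1 (Fin.last (0 + 1 + 1))) ∧ z (Fin.castAdd 1 (Fin.last (0 + 1 + 1))) < affB (0 + 1 + 1) 1 yhi' z)) →
      (∀ z : Fin (0 + 1 + 1 + 1 + 1) → ℝ, (∀ j, 0 < affB (0 + 1 + 1) 1 (M₀' j) z) → affB (0 + 1 + 1) 1 ylo' z < affB (0 + 1 + 1) 1 yhi' z) →
      (∀ z : Fin (0 + 1 + 1 + 1 + 1) → ℝ, (∀ j, 0 < affB (0 + 1 + 1) 1 (M₀' j) z) →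
        (0 < u'.1 (Fin.last (0 + 1 + 1)) → affB (0 + 1 + 1) 1 ℓ₂ z ≤ affB (0 + 1 + 1) 1 ylo' z) ∧ (u'.1 (Fin.last (0 + 1 + 1)) < 0 → affB (0 + 1 + 1) 1 yhi' z ≤ affB (0 + 1 + 1) 1 ℓ₂ z)) →
      (∀ z : Fin (0 + 1 + 1 + 1 + 1) → ℝ, (∀ j, 0 < affB (0 + 1 + 1) 1 (M₀' j) z) →
        affF (0 + 1 + 1) 1 v' z - affF (0 + 1 + 1) 1 u' z < ε * (affB (0 + 1 + 1) 1 yhi' z - affB (0 + 1 + 1) 1 ylo' z)) →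
      (∃ δ : ℝ, 0 < δ ∧ ∀ z : Fin (0 + 1 + 1 + 1 + 1) → ℝ, (∀ j, 0 < affB (0 + 1 + 1) 1 (M₀' j) z) →
        δ ≤ |affB (0 + 1 + 1) 1 ylo' z - affB (0 + 1 + 1) 1 ℓ₂ z| ∧ δ ≤ |affB (0 + 1 + 1) 1 yhi' z - affB (0 + 1 + 1) 1 ℓ₂ z|) →
      (∃ z ∈ closure {z : Fin (0 + 1 + 1 + 1 + 1) → ℝ | ∀ j, 0 < affF (0 + 1 + 1) 1 (M' j) z},
        affB (0 + 1 + 1) 1 ylo' z = affB (0 + 1 + 1) 1 yhi' z ∧ affF (0 + 1 + 1) 1 u' z = affF (0 + 1 + 1) 1 v' z ∧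
          affB (0 + 1 + 1) 1 (restr (0 + 1 + 1) u') z + (u'.1 (Fin.last (0 + 1 + 1)) : ℝ) * affB (0 + 1 + 1) 1 ℓ₂ z = 0) →
      ∃ c ∈ AddSubgroup.closure (GGset (0 + 1 + 1) 2 1), KZ.of s' - c ∈ KZ.relations) :
    ∃ c ∈ AddSubgroup.closure (GGset (0 + 1 + 1) 2 1), KZ.of s - c ∈ KZ.relations :=
  good_dfar_of_par L e ℓ₁ ℓ₂ s M p u v κ A hbd hdom hint hκ hA hA0 hcell
    fun _ s' M' u' v' hbd' hdom' hint' hu' hpar' hcell' =>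
      good_par_two_of_HU L e ℓ₁ ℓ₂ ε hε s' M' p u' v' hbd' hdom' hint' hu' hpar' hcell' (HU u' v' hu' hpar')

end TwoOfHU

end RebasePos

/-- **Registered part of `stub_rebaseSimplePosOnePos` (line `janus-bands`): the residual
hypothesis `Hpar` of the one-fibre rebase at `B = 2` follows from the single residue `HU`**
(`RebasePos.good_par_two_of_HU`: product cells, thick / non-pinching / level-split pieces,
triple and quadruple points by parts `ParTriple*`, `ParThinQuad*`, `Quad*`; what is left are the
`ε`-thin far-side cells with a triple point at pole distance `≥ δ`). -/
theorem rebaseSimplePos_par_two_of_HU (m m' : ℕ) (L : Fin m → (Fin (0 + 1 + 1) → ℚ) × ℚ) (e : Fin m → ℕ) (ℓ₁ ℓ₂ : (Fin (0 + 1 + 1) → ℚ) × ℚ) (ε : ℚ) (hε : 0 < ε) (s : KZ.IntegralRep (0 + 1 + 1 + 1 + 1)) (M : Fin m' → (Fin (0 + 1 + 1 + 1) → ℚ) × ℚ) (p : MvPolynomial (Fin (0 + 1 + 1)) ℚ) (u v : (Fin (0 + 1 + 1 + 1) → ℚ) × ℚ) (hbd : Bornology.IsBounded s.domain) (hdom :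 s.domain = SeparatePos.gDom (0 + 1 + 1) 1 m' M (fun _ => Sum.inr u) (fun _ => Sum.inr v)) (hint : Set.EqOn s.integrand (RebasePos.glit (0 + 1 + 1) 1 p L e ℓ₁ ℓ₂ 0 1 (fun _ => some 0)) s.domain) (hu : u.1 (Fin.last (0 + 1 + 1)) ≠ 0) (hpar : u.1 (Fin.last (0 + 1 + 1)) = v.1 (Fin.last (0 + 1 + 1))) (hcell : ∀ z : Fin (0 + 1 + 1 + 1 + 1) → ℝ, (∀ j, 0 < SeparatePos.affF (0 + 1 + 1) 1 (M j) z) → 0 < SeparatePos.affF (0 + 1 + 1) 1 u z ∧ SeparatePos.affF (0 + 1 + 1) 1 u z < SeparatePos.affF (0 + 1 + 1) 1 v z) (HU : ∀ (m'' m₀' : ℕ) (s' : KZ.IntegralRep (0 + 1 + 1 + 1 + 1)) (M' : Fin m'' → (Fin (0 + 1 + 1 + 1) → ℚ) × ℚ) (M₀' : Fin m₀' → (Fin (0 + 1 + 1) → ℚ) × ℚ) (ylo' yhi' : (Fin (0 + 1 + 1) → ℚ) × ℚ), Bornology.IsBounded s'.domain → s'.domain = SeparatePos.gDom (0 + 1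 + 1) 1 m'' M' (fun _ => Sum.inr u) (fun _ => Sum.inr v) → Set.EqOn s'.integrand (RebasePos.glit (0 + 1 + 1) 1 p L e ℓ₁ ℓ₂ 0 1 (fun _ => some 0)) s'.domain → (∀ z : Fin (0 + 1 + 1 + 1 + 1) → ℝ, (∀ j, 0 < SeparatePos.affF (0 + 1 + 1) 1 (M' j) z) → 0 < SeparatePos.affF (0 + 1 + 1) 1 u z ∧ SeparatePos.affF (0 + 1 + 1) 1 u z < SeparatePos.affF (0 + 1 + 1) 1 v z) → (∀ z : Fin (0 + 1 + 1 + 1 + 1) → ℝ, (∀ j, 0 < SeparatePos.affF (0 + 1 + 1) 1 (M' j) z) ↔ ((∀ j, 0 < SeparatePos.affB (0 + 1 + 1) 1 (M₀' j) z) ∧ SeparatePos.affB (0 + 1 + 1) 1 ylo' z < z (Fin.castAdd 1 (Fin.last (0 + 1 + 1))) ∧ z (Fin.castAdd 1 (Fin.last (0 + 1 + 1))) < SeparatePos.affB (0 + 1 + 1) 1 yhi' z)) → (∀ z : Fin (0 + 1 + 1 + 1 + 1) → ℝ, (∀ j, 0 < SeparatePos.affB (0 + 1 + 1) 1 (M₀'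 j) z) → SeparatePos.affB (0 + 1 + 1) 1 ylo' z < SeparatePos.affB (0 + 1 + 1) 1 yhi' z) → (∀ z : Fin (0 + 1 + 1 + 1 + 1) → ℝ, (∀ j, 0 < SeparatePos.affB (0 + 1 + 1) 1 (M₀' j) z) → (0 < u.1 (Fin.last (0 + 1 + 1)) → SeparatePos.affB (0 + 1 + 1) 1 ℓ₂ z ≤ SeparatePos.affB (0 + 1 + 1) 1 ylo' z) ∧ (u.1 (Fin.last (0 + 1 + 1)) < 0 → SeparatePos.affB (0 + 1 + 1) 1 yhi' z ≤ SeparatePos.affB (0 + 1 + 1) 1 ℓ₂ z)) → (∀ z : Fin (0 + 1 + 1 + 1 + 1) → ℝ, (∀ j, 0 < SeparatePos.affB (0 + 1 + 1) 1 (M₀' j) z) → SeparatePos.affF (0 + 1 + 1) 1 v z - SeparatePos.affF (0 + 1 + 1) 1 u z < ε * (SeparatePos.affB (0 + 1 + 1) 1 yhi' z - SeparatePos.affB (0 + 1 + 1) 1 ylo' z)) → (∃ δ : ℝ, 0 < δ ∧ ∀ z : Fin (0 + 1 + 1 + 1 + 1) → ℝ, (∀ j, 0 < SeparatePos.affB (0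 + 1 + 1) 1 (M₀' j) z) → δ ≤ |SeparatePos.affB (0 + 1 + 1) 1 ylo' z - SeparatePos.affB (0 + 1 + 1) 1 ℓ₂ z| ∧ δ ≤ |SeparatePos.affB (0 + 1 + 1) 1 yhi' z - SeparatePos.affB (0 + 1 + 1) 1 ℓ₂ z|) → (∃ z ∈ closure {z : Fin (0 + 1 + 1 + 1 + 1) → ℝ | ∀ j, 0 < SeparatePos.affF (0 + 1 + 1) 1 (M' j) z}, SeparatePos.affB (0 + 1 + 1) 1 ylo' z = SeparatePos.affB (0 + 1 + 1) 1 yhi' z ∧ SeparatePos.affF (0 + 1 + 1) 1 u z = SeparatePos.affF (0 + 1 + 1) 1 v z ∧ SeparatePos.affB (0 + 1 + 1) 1 (SeparatePos.restr (0 + 1 + 1) u) z + (u.1 (Fin.last (0 + 1 + 1)) : ℝ) * SeparatePos.affB (0 + 1 + 1) 1 ℓ₂ z = 0) → ∃ c ∈ AddSubgroup.closure (SeparatePos.GGset (0 + 1 + 1) 2 1), KZ.of s' - c ∈ KZ.relations) : ∃ c ∈ AddSubgroup.closure (SeparatePos.GGset (0 + 1 + 1) 2 1), KZ.of s - c ∈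 KZ.relations :=
  RebasePos.good_par_two_of_HU L e ℓ₁ ℓ₂ ε hε s M p u v hbd hdom hint hu hpar hcell HU

/-- **The stub `stub_rebaseSimplePosOnePos` at `b = 0` modulo the residue `HU` alone** (exactly
its signature at `b = 0` plus `ε`, `hε`, `HU`; compare `rebaseSimplePosOnePos_two_of_U'`, whose
double-corner hypotheses `Hdthick`, `Hdfar` are discharged here by part `DCornerPar`):
`GS 2 1 → closure (GG 2 2 1 ∪ JJ 2 2 ∪ JD 3)` modulo `KZ.relations`. -/
theorem rebaseSimplePosOnePos_two_of_HU' (GS : ℕ → ℕ → Set KZ.FormalRep) (GG : ℕ → ℕ → ℕ → Set KZ.FormalRep) (hGS : ∀ b k, GS b k = {w : KZ.FormalRep | ∃ (m m' n₁ n₂ : ℕ) (s : KZ.IntegralRep (b + 1 + k)) (M : Fin m' → (Fin (b + 1) → ℚ) × ℚ) (L : Fin m → (Fin b → ℚ) × ℚ) (e : Fin m → ℕ) (p : MvPolynomial (Fin b) ℚ) (ℓ₁ ℓ₂ : (Fin b → ℚ) × ℚ) (a : Fin k → Option ((Fin (b + 1) → ℚ) × ℚ)) (lo hi : Fin k → Fin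 k ⊕ ((Fin (b + 1) → ℚ) × ℚ)), (n₁ = 0 ∨ n₂ = 0) ∧ n₂ = 1 ∧ Bornology.IsBounded s.domain ∧ s.domain = {z | (∀ j, 0 < ∑ i, ((M j).1 i : ℝ) * z (Fin.castAdd k i) + ((M j).2 : ℝ)) ∧ ∀ i, Sum.elim (fun j => z (Fin.natAdd (b + 1) j)) (fun c => ∑ i', (c.1 i' : ℝ) * z (Fin.castAdd k i') + (c.2 : ℝ)) (lo i) < z (Fin.natAdd (b + 1) i) ∧ z (Fin.natAdd (b + 1) i) < Sum.elim (fun j => z (Fin.natAdd (b + 1) j)) (fun c => ∑ i', (c.1 i' : ℝ) * z (Fin.castAdd k i') + (c.2 : ℝ)) (hi i)} ∧ EqOn s.integrand (fun z => MvPolynomial.aeval (fun i => z (Fin.castAdd k (Fin.castSucc i))) p / (∏ j, (∑ i, ((L j).1 i : ℝ) * z (Fin.castAdd k (Fin.castSucc i)) + ((L j).2 : ℝ)) ^ e j) * ((z (Fin.castAdd k (Fin.last b)) - (∑ i, (ℓ₁.1 i : ℝ) * z (Fin.castAdd k (Fin.castSucc i)) + (ℓ₁.2 : ℝ))) ^ n₁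 / (z (Fin.castAdd k (Fin.last b)) - (∑ i, (ℓ₂.1 i : ℝ) * z (Fin.castAdd k (Fin.castSucc i)) + (ℓ₂.2 : ℝ))) ^ n₂) * ∏ i, (a i).elim 1 (fun c => 1 / (z (Fin.natAdd (b + 1) i) - (∑ i', (c.1 i' : ℝ) * z (Fin.castAdd k i') + (c.2 : ℝ))))) s.domain ∧ w = KZ.of s}) (hGG : ∀ b σ k, GG b σ k = {w : KZ.FormalRep | ∃ (m m' n₁ n₂ : ℕ) (s : KZ.IntegralRep (b + 1 + k)) (M : Fin m' → (Fin (b + 1) → ℚ) × ℚ) (L : Fin m → (Fin b → ℚ) × ℚ) (e : Fin m → ℕ) (p : MvPolynomial (Fin b) ℚ) (ℓ₁ ℓ₂ : (Fin b → ℚ) × ℚ) (a : Fin k → Option ((Fin (b + 1) → ℚ) × ℚ)) (lo hi : Fin k → Fin k ⊕ ((Fin (b + 1) → ℚ) × ℚ)), (n₁ = 0 ∨ n₂ = 0) ∧ (σ = 2 → (∀ i c, a i = some c → c.1 (Fin.last b) = 0) ∧ (∀ i c, (lo i = Sum.inr c ∨ hi i = Sum.inr c) → (c.1 (Fin.last b)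 = 0 ∨ c = (Pi.single (Fin.last b) 1, 0)))) ∧ Bornology.IsBounded s.domain ∧ s.domain = {z | (∀ j, 0 < ∑ i, ((M j).1 i : ℝ) * z (Fin.castAdd k i) + ((M j).2 : ℝ)) ∧ ∀ i, Sum.elim (fun j => z (Fin.natAdd (b + 1) j)) (fun c => ∑ i', (c.1 i' : ℝ) * z (Fin.castAdd k i') + (c.2 : ℝ)) (lo i) < z (Fin.natAdd (b + 1) i) ∧ z (Fin.natAdd (b + 1) i) < Sum.elim (fun j => z (Fin.natAdd (b + 1) j)) (fun c => ∑ i', (c.1 i' : ℝ) * z (Fin.castAdd k i') + (c.2 : ℝ)) (hi i)} ∧ EqOn s.integrand (fun z => MvPolynomial.aeval (fun i => z (Fin.castAdd k (Fin.castSucc i))) p / (∏ j, (∑ i, ((L j).1 i : ℝ) * z (Fin.castAdd k (Fin.castSucc i)) + ((L j).2 : ℝ)) ^ e j) * ((z (Fin.castAdd k (Fin.last b)) - (∑ i, (ℓ₁.1 i : ℝ) * z (Fin.castAdd k (Fin.castSucc i)) + (ℓ₁.2 : ℝ))) ^ n₁ / (z (Fin.castAdd k (Fin.last b)) - (∑ i,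 (ℓ₂.1 i : ℝ) * z (Fin.castAdd k (Fin.castSucc i)) + (ℓ₂.2 : ℝ))) ^ n₂) * ∏ i, (a i).elim 1 (fun c => 1 / (z (Fin.natAdd (b + 1) i) - (∑ i', (c.1 i' : ℝ) * z (Fin.castAdd k i') + (c.2 : ℝ))))) s.domain ∧ w = KZ.of s}) (JJ : ℕ → ℕ → Set KZ.FormalRep) (JD : ℕ → Set KZ.FormalRep) (hJJ : ∀ b k, JJ b k = {w : KZ.FormalRep | ∃ (m m' : ℕ) (s : KZ.IntegralRep (b + k)) (M : Fin m' → (Fin b → ℚ) × ℚ) (L : Fin m → (Fin b → ℚ) × ℚ) (e : Fin m → ℕ) (p : MvPolynomial (Fin b) ℚ) (a : Fin k → Option ((Fin b → ℚ) × ℚ)) (lo hi : Fin k → Fin k ⊕ ((Fin b → ℚ) × ℚ)), Bornology.IsBounded s.domain ∧ s.domain = {z | (∀ j, 0 < ∑ i, ((M j).1 i : ℝ) * z (Fin.castAdd k i) + ((M j).2 : ℝ)) ∧ ∀ i, Sum.elim (fun j => z (Fin.natAdd b j)) (fun c => ∑ i', (c.1 i' : ℝ) * z (Fin.castAdd k i')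 + (c.2 : ℝ)) (lo i) < z (Fin.natAdd b i) ∧ z (Fin.natAdd b i) < Sum.elim (fun j => z (Fin.natAdd b j)) (fun c => ∑ i', (c.1 i' : ℝ) * z (Fin.castAdd k i') + (c.2 : ℝ)) (hi i)} ∧ EqOn s.integrand (fun z => MvPolynomial.aeval (fun i => z (Fin.castAdd k i)) p / (∏ j, (∑ i, ((L j).1 i : ℝ) * z (Fin.castAdd k i) + ((L j).2 : ℝ)) ^ e j) * ∏ i, (a i).elim 1 (fun c => 1 / (z (Fin.natAdd b i) - (∑ i', (c.1 i' : ℝ) * z (Fin.castAdd k i') + (c.2 : ℝ))))) s.domain ∧ w = KZ.of s}) (hJD : ∀ N, JD N = {w : KZ.FormalRep | ∃ b' k', b' + k' = N ∧ w ∈ JJ b' k'}) (ε : ℚ) (hε : 0 < ε) (HU : ∀ (m : ℕ) (L : Fin m → (Fin (0 + 1 + 1) → ℚ) × ℚ) (e : Fin m → ℕ) (ℓ₁ ℓ₂ : (Fin (0 + 1 + 1) → ℚ) × ℚ) (p : MvPolynomial (Fin (0 + 1 + 1)) ℚ) (u v : (Fin (0 + 1 + 1 + 1) → ℚ) × ℚ),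 u.1 (Fin.last (0 + 1 + 1)) ≠ 0 → u.1 (Fin.last (0 + 1 + 1)) = v.1 (Fin.last (0 + 1 + 1)) → ∀ (m'' m₀' : ℕ) (s' : KZ.IntegralRep ((0 + 1 + 1) + 1 + 1)) (M' : Fin m'' → (Fin (0 + 1 + 1 + 1) → ℚ) × ℚ) (M₀' : Fin m₀' → (Fin (0 + 1 + 1) → ℚ) × ℚ) (ylo' yhi' : (Fin (0 + 1 + 1) → ℚ) × ℚ), Bornology.IsBounded s'.domain → s'.domain = SeparatePos.gDom (0 + 1 + 1) 1 m'' M' (fun _ => Sum.inr u) (fun _ => Sum.inr v) → EqOn s'.integrand (RebasePos.glit (0 + 1 + 1) 1 p L e ℓ₁ ℓ₂ 0 1 (fun _ => some 0)) s'.domain → (∀ z : Fin (0 + 1 + 1 + 1 + 1) → ℝ, (∀ j, 0 < SeparatePos.affF (0 + 1 + 1) 1 (M' j) z) → 0 < SeparatePos.affF (0 + 1 + 1) 1 u z ∧ SeparatePos.affF (0 + 1 + 1) 1 u z < SeparatePos.affF (0 + 1 + 1) 1 v z) → (∀ z : Fin (0 + 1 + 1 + 1 + 1) → ℝ, (∀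 j, 0 < SeparatePos.affF (0 + 1 + 1) 1 (M' j) z) ↔ ((∀ j, 0 < SeparatePos.affB (0 + 1 + 1) 1 (M₀' j) z) ∧ SeparatePos.affB (0 + 1 + 1) 1 ylo' z < z (Fin.castAdd 1 (Fin.last (0 + 1 + 1))) ∧ z (Fin.castAdd 1 (Fin.last (0 + 1 + 1))) < SeparatePos.affB (0 + 1 + 1) 1 yhi' z)) → (∀ z : Fin (0 + 1 + 1 + 1 + 1) → ℝ, (∀ j, 0 < SeparatePos.affB (0 + 1 + 1) 1 (M₀' j) z) → SeparatePos.affB (0 + 1 + 1) 1 ylo' z < SeparatePos.affB (0 + 1 + 1) 1 yhi' z) → (∀ z : Fin (0 + 1 + 1 + 1 + 1) → ℝ, (∀ j, 0 < SeparatePos.affB (0 + 1 + 1) 1 (M₀' j) z) → (0 < u.1 (Fin.last (0 + 1 + 1)) → SeparatePos.affB (0 + 1 + 1) 1 ℓ₂ z ≤ SeparatePos.affB (0 + 1 + 1) 1 ylo' z) ∧ (u.1 (Fin.last (0 + 1 + 1)) < 0 → SeparatePos.affB (0 + 1 + 1) 1 yhi' z ≤ SeparatePos.affB (0 + 1 +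 1) 1 ℓ₂ z)) → (∀ z : Fin (0 + 1 + 1 + 1 + 1) → ℝ, (∀ j, 0 < SeparatePos.affB (0 + 1 + 1) 1 (M₀' j) z) → SeparatePos.affF (0 + 1 + 1) 1 v z - SeparatePos.affF (0 + 1 + 1) 1 u z < ε * (SeparatePos.affB (0 + 1 + 1) 1 yhi' z - SeparatePos.affB (0 + 1 + 1) 1 ylo' z)) → ((∃ δ : ℝ, 0 < δ ∧ ∀ z : Fin (0 + 1 + 1 + 1 + 1) → ℝ, (∀ j, 0 < SeparatePos.affB (0 + 1 + 1) 1 (M₀' j) z) → δ ≤ |SeparatePos.affB (0 + 1 + 1) 1 ylo' z - SeparatePos.affB (0 + 1 + 1) 1 ℓ₂ z| ∧ δ ≤ |SeparatePos.affB (0 + 1 + 1) 1 yhi' z - SeparatePos.affB (0 + 1 + 1) 1 ℓ₂ z|) ∧ (∃ z ∈ closure {z : Fin (0 + 1 + 1 + 1 + 1) → ℝ | ∀ j, 0 < SeparatePos.affF (0 + 1 + 1) 1 (M' j) z}, SeparatePos.affB (0 + 1 + 1) 1 ylo' z = SeparatePos.affB (0 + 1 + 1) 1 yhi' z ∧ SeparatePos.affF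 (0 + 1 + 1) 1 u z = SeparatePos.affF (0 + 1 + 1) 1 v z ∧ SeparatePos.affB (0 + 1 + 1) 1 (SeparatePos.restr (0 + 1 + 1) u) z + (u.1 (Fin.last (0 + 1 + 1)) : ℝ) * SeparatePos.affB (0 + 1 + 1) 1 ℓ₂ z = 0)) → ∃ c ∈ AddSubgroup.closure (SeparatePos.GGset (0 + 1 + 1) 2 1), KZ.of s' - c ∈ KZ.relations) : ∀ x ∈ GS (0 + 2) 1, ∃ c ∈ AddSubgroup.closure (GG (0 + 2) 2 1 ∪ JJ (0 + 2) 2 ∪ JD (0 + 3)), x - c ∈ KZ.relations :=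
  rebaseSimplePosOnePos_two_of_U' GS GG hGS hGG JJ JD hJJ hJD ε hε HU
    (fun m L e ℓ₁ ℓ₂ _ s M p u v κ A hbd hdom hint hκ hA hA0 hcell _ =>
      RebasePos.good_dthick_two_of_HU L e ℓ₁ ℓ₂ ε hε s M p u v κ A hbd hdom hint hκ hA hA0 hcell
        fun u' v' hu' hpar' m'' m₀' s' M' M₀' ylo' yhi' hbd' hdom' hint' hcell' hsec' hne' hside' hthin' hδ htr =>
          HU m L e ℓ₁ ℓ₂ p u' v' hu' hpar' m'' m₀' s' M' M₀' ylo' yhi' hbd' hdom' hint' hcell' hsec' hne' hside'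
            hthin' ⟨hδ, htr⟩)
    (fun m L e ℓ₁ ℓ₂ _ s M p u v κ A hbd hdom hint hκ hA hA0 hcell _ =>
      RebasePos.good_dfar_two_of_HU L e ℓ₁ ℓ₂ ε hε s M p u v κ A hbd hdom hint hκ hA hA0 hcell
        fun u' v' hu' hpar' m'' m₀' s' M' M₀' ylo' yhi' hbd' hdom' hint' hcell' hsec' hne' hside' hthin' hδ htr =>
          HU m L e ℓ₁ ℓ₂ p u' v' hu' hpar' m'' m₀' s' M' M₀' ylo' yhi' hbd' hdom' hint' hcell' hsec' hne' hside'
            hthin' ⟨hδ, htr⟩)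

end Summit.KontsevichZagierPeriods.ArrangementNormalForm.JanusBands
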